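import Summits.ResolutionOfSingularities.ResolutionOfSingularities.Theorems.HilbertSamuelEliminationSigmaMaxModificationsCorridor3CPFramePropagationChart
import Summits.ResolutionOfSingularities.ResolutionOfSingularities.Theorems.HilbertSamuelEliminationSigmaMaxModificationsCorridor3WLadderCPFrameTranslate
import Literature.AlgebraicGeometry.Resolution.LogRegularEtaleLocal
import Literature.RingTheory.KrullDimension.AffineDimension
import Literature.RingTheory.HilbertSamuel.FlatBaseChange
import Literature.AlgebraicGeometry.Resolution.BlowupChartTransition
import HarnessLib

/-!
# [OURS · L1 W4.2] D18 G5 (ii-c): the presentation at a NEAR point becomes a frame over the regular local ring `S_𝔮` — the order of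
# `h'` persists (G4/G5 i), the fibre polynomial is `(X − θ̄')^m` (p529392), `S_𝔮[X]/(h')` is local (p527785), and the translate `h'(X + θ')`
# has `δ ≥ 1`
# (cell res-hironaka, LADDER-RESOLUTION rung L; slot W4.2, crux chain w42 `SigmaMaxModificationsCorridor3` stmt-ResolutionOfSingularities-19249;
# `--supports stmt-ResolutionOfSingularities-19249 --as helper`; hand res-D-brk-3 (gen 6), cut G5 of TAKING 13:03:41Z)

PURE COMMUTATIVE ALGEBRA (universe `0`, as `IsCPFrame`), 0 `def`s, every declaration PROVED; OURS bookkeeping; NOT a statement of Hironaka's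
manuscript [Hironaka2017] nor of [CossartJannsenSaito2020]/[CossartPiltant2019]. AI-written, weaker than expert review.

* **`exists_local_frame_of_chart_presentation`** — INPUT: the output of `exists_adjoinRoot_chart_presentation` (G5 ii-b), stated over
  any Noetherian domain `S` (there `S = R[(u)/u_{j₀}]`): a monic `h' ∈ S[X]` of degree `m = deg h`, a prime `𝔔₃` of `S[X]/(h')` with
  `𝔮 = 𝔔₃ ∩ S` such that `S_𝔮` is regular (G5 ii-a for the chart algebra), a presentation `ψ₃ : O₀ → (S[X]/(h'))_{𝔔₃}`, together with
  the NEARNESS of the point in Hilbert–Samuel form, `H^{(0)}(O₀) = H^{(0)}(R[X]/(h))` and `dim O₀ = dim R[X]/(h)` (tree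
  `Moving.hilbertFun_stalk_eq_of_canonicalNearStep`, `ringKrullDim_stalk_eq_of_canonicalNearStep` plus the flat presentation at `x_n`).
  OUTPUT: `S_𝔮` has the dimension of `R`, and for some `θ' ∈ S_𝔮` the translate
  `h₁ = h'_{S_𝔮}(X + θ')` is monic of degree `m` with `coeff_i h₁ ∈ 𝔪_{S_𝔮}^{m−i}`, `S_𝔮[X]/(h₁)` is local, and `O₀ → S_𝔮[X]/(h₁)` is a
  presentation (flat, local, `𝔪 ↦ 𝔪` onto, residue-onto) — every clause of a CP frame at the near point except minimality, over the
  NON-complete base `S_𝔮` (next file: completion + Hironaka's vertex preparation, res-lit-4's theorem).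

References: CJS LNM 2270 §2.2 [CossartJannsenSaito2020]; CP 2019 Prop. 2.6, (2.7) [CossartPiltant2019]; Matsumura 15.1, 19.5 [Matsumura1987]; tree
G1–G5(ii-b), 050's p527785/p521363, p529392.
-/

noncomputable section

set_option linter.dupNamespace false

open IsLocalRing IsLocalization Polynomial
open Literature.AlgebraicGeometry.Resolution Literature.RingTheory.HilbertSamuel
open Summit.ResolutionOfSingularities.ResolutionOfSingularities.Theorems.SigmaMaxModificationsCorridor3.Moving

namespace Summit.ResolutionOfSingularities.ResolutionOfSingularities.Theorems.SigmaMaxModificationsCorridor3.Helpers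

/-- [OURS · L1 W4.2] **The frame at a near point, over `S_𝔮`.** See the module docstring. [cite: CossartPiltant2019, Prop. 2.6 and (2.7) (arXiv v1 pp. 13–14)]
[cite: CossartJannsenSaito2020, Thm. 2.3, §2.2] -/
theorem exists_local_frame_of_chart_presentation {R : Type} [CommRing R] [IsRegularLocalRing R] {h : R[X]} (hmo : h.Monic)
    (hm : 0 < h.natDegree) (hco : ∀ i < h.natDegree, h.coeff i ∈ maximalIdeal R ^ (h.natDegree - i)) [IsLocalRing (AdjoinRoot h)]
    {S : Type} [CommRing S] [IsDomain S] [IsNoetherianRing S] (q : Ideal S) [q.IsPrime]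
    (hreg : IsRegularLocalRing (Localization.AtPrime q)) {h' : S[X]} (hmon' : h'.Monic) (hdeg' : h'.natDegree = h.natDegree)
    (𝔔₃ : Ideal (AdjoinRoot h')) [𝔔₃.IsPrime] (hq : (𝔔₃.comap (AdjoinRoot.mk h')).comap C = q)
    {O₀ : Type} [CommRing O₀] [IsLocalRing O₀] [IsNoetherianRing O₀] (ψ₃ : O₀ →+* Localization.AtPrime 𝔔₃)
    (hflat : @RingHom.Flat O₀ (Localization.AtPrime 𝔔₃) _ _ ψ₃) (hloc : IsLocalHom ψ₃)
    (hmap : (maximalIdeal O₀).map ψ₃ = maximalIdeal (Localization.AtPrime 𝔔₃))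
    (hres : Function.Surjective ((residue (Localization.AtPrime 𝔔₃)).comp ψ₃))
    (hH : hilbertFun O₀ = hilbertFun (AdjoinRoot h)) (hdimO : ringKrullDim O₀ = ringKrullDim (AdjoinRoot h)) :
    ∃ (θ' : Localization.AtPrime q)
      (_ : IsLocalRing ((Localization.AtPrime q)[X] ⧸ Ideal.span {(h'.map (algebraMap S (Localization.AtPrime q))).comp (X + C θ')}))
      (φ₁ : O₀ →+* (Localization.AtPrime q)[X] ⧸ Ideal.span {(h'.map (algebraMap S (Localization.AtPrime q))).comp (X + C θ')}),
      ringKrullDim (Localization.AtPrime q) = ringKrullDim R ∧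
      ((h'.map (algebraMap S (Localization.AtPrime q))).comp (X + C θ')).Monic ∧
      ((h'.map (algebraMap S (Localization.AtPrime q))).comp (X + C θ')).natDegree = h.natDegree ∧
      (∀ i < h.natDegree, ((h'.map (algebraMap S (Localization.AtPrime q))).comp (X + C θ')).coeff i ∈
        maximalIdeal (Localization.AtPrime q) ^ (h.natDegree - i)) ∧
      @RingHom.Flat O₀ ((Localization.AtPrime q)[X] ⧸
        Ideal.span {(h'.map (algebraMap S (Localization.AtPrime q))).comp (X + C θ')}) _ _ φ₁ ∧ IsLocalHom φ₁ ∧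
      (maximalIdeal O₀).map φ₁ = maximalIdeal ((Localization.AtPrime q)[X] ⧸
        Ideal.span {(h'.map (algebraMap S (Localization.AtPrime q))).comp (X + C θ')}) ∧
      Function.Surjective ((residue ((Localization.AtPrime q)[X] ⧸
        Ideal.span {(h'.map (algebraMap S (Localization.AtPrime q))).comp (X + C θ')})).comp φ₁) := by
  haveI := hreg
  have hreg' : IsRegularLocalRing (Localization.AtPrime ((𝔔₃.comap (AdjoinRoot.mk h')).comap C)) := by
    subst hq
    exact hreg
  -- the Hilbert function and the dimension of `(S[X]/(h'))_{𝔔₃}`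
  haveI : IsNoetherianRing (AdjoinRoot h') := inferInstance
  haveI : IsNoetherianRing (Localization.AtPrime 𝔔₃) := IsLocalization.isNoetherianRing 𝔔₃.primeCompl _ inferInstance
  letI algψ : Algebra O₀ (Localization.AtPrime 𝔔₃) := ψ₃.toAlgebra
  haveI : Module.Flat O₀ (Localization.AtPrime 𝔔₃) := hflat
  haveI : IsLocalHom (algebraMap O₀ (Localization.AtPrime 𝔔₃)) := hloc
  have hH₃ : hilbertFun (Localization.AtPrime 𝔔₃) = hilbertFun (AdjoinRoot h) :=
    (hilbertFun_eq_of_flat_of_map_maximalIdeal_eq (A := O₀) (B := Localization.AtPrime 𝔔₃) hmap).trans hH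
  have hdim₃ : ringKrullDim (Localization.AtPrime 𝔔₃) = ringKrullDim (AdjoinRoot h) :=
    (Literature.AlgebraicGeometry.Resolution.ringKrullDim_eq_of_flat_of_map_maximalIdeal_eq O₀ (Localization.AtPrime 𝔔₃) hmap).trans hdimO
  -- near ⇒ order
  obtain ⟨s, hs, hsh⟩ := exists_mul_mem_pow_of_hilbertFun_eq hmo hm hco hmon' 𝔔₃ hreg' hH₃ hdim₃
  have hm' : 0 < h'.natDegree := by rw [hdeg']; exact hm
  have hord : ∃ s ∉ 𝔔₃.comap (AdjoinRoot.mk h'), s * h' ∈ (𝔔₃.comap (AdjoinRoot.mk h')) ^ h'.natDegree :=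
    ⟨s, hs, by rw [hdeg']; exact hsh⟩
  -- NEAR-SHAPE (p529392) at `𝔮`
  obtain ⟨θ', h𝔔₄, hcomap, hfib, hmo₁, hdeg₁, hco₁, hweak⟩ :=
    exists_frame_translate_localization_of_order q hmon' hm' hq hord
  -- the local ring `B' = S_𝔮[X]/(h')` (p527785) and `(S[X]/(h'))_{𝔔₃} ≅ B'`
  obtain ⟨hlocB', hmaxB', hq', hlocAt, huniq⟩ := adjoinRoot_localization_of_fibre q hmon' hm' θ' hweak
  haveI := hlocB'
  letI algM : Algebra (AdjoinRoot h') (AdjoinRoot (h'.map (algebraMap S (Localization.AtPrime q)))) :=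
    (AdjoinRoot.map (algebraMap S (Localization.AtPrime q)) h' (h'.map (algebraMap S (Localization.AtPrime q))) dvd_rfl).toAlgebra
  have h𝔔₃eq : 𝔔₃ = (maximalIdeal (AdjoinRoot (h'.map (algebraMap S (Localization.AtPrime q))))).comap
      (AdjoinRoot.map (algebraMap S (Localization.AtPrime q)) h' _ dvd_rfl) :=
    huniq 𝔔₃ inferInstance (by rw [show AdjoinRoot.of h' = (AdjoinRoot.mk h').comp C from rfl, ← Ideal.comap_comap]; exact hq)
  have hM : ((maximalIdeal (AdjoinRoot (h'.map (algebraMap S (Localization.AtPrime q))))).comap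
      (AdjoinRoot.map (algebraMap S (Localization.AtPrime q)) h' _ dvd_rfl)).primeCompl = 𝔔₃.primeCompl := by
    ext x
    rw [Ideal.mem_primeCompl_iff, Ideal.mem_primeCompl_iff, ← h𝔔₃eq]
  have hlocAt' : IsLocalization.AtPrime (AdjoinRoot (h'.map (algebraMap S (Localization.AtPrime q)))) 𝔔₃ := by
    have h1 := hlocAt
    change IsLocalization _ _ at h1
    change IsLocalization _ _
    rwa [hM] at h1
  let e₄ : Localization.AtPrime 𝔔₃ ≃ₐ[AdjoinRoot h'] AdjoinRoot (h'.map (algebraMap S (Localization.AtPrime q))) :=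
    @IsLocalization.algEquiv (AdjoinRoot h') _ 𝔔₃.primeCompl (Localization.AtPrime 𝔔₃) _ _ _ _ _ _ hlocAt'
  -- the translation `X ↦ X − θ'`
  let e₅ : AdjoinRoot (h'.map (algebraMap S (Localization.AtPrime q))) ≃+*
      (Localization.AtPrime q)[X] ⧸ Ideal.span {(h'.map (algebraMap S (Localization.AtPrime q))).comp (X + C θ')} :=
    Ideal.quotientEquiv (Ideal.span {h'.map (algebraMap S (Localization.AtPrime q))})
      (Ideal.span {(h'.map (algebraMap S (Localization.AtPrime q))).comp (X + C θ')})
      (algEquivAevalXAddC θ' : (Localization.AtPrime q)[X] ≃ₐ[Localization.AtPrime q] (Localization.AtPrime q)[X]).toRingEquiv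
      (by rw [span_translate_eq_map]; rfl)
  haveI hloc₁ : IsLocalRing ((Localization.AtPrime q)[X] ⧸
      Ideal.span {(h'.map (algebraMap S (Localization.AtPrime q))).comp (X + C θ')}) := e₅.isLocalRing
  -- the presentation on `S_𝔮[X]/(h₁)`
  obtain ⟨hf₄, hl₄, hm₄, hr₄⟩ := presentation_comp_ringEquiv (T := Localization.AtPrime 𝔔₃)
    (T' := AdjoinRoot (h'.map (algebraMap S (Localization.AtPrime q)))) ψ₃ hflat hloc hmap hres e₄.toRingEquiv
  obtain ⟨hf₅, hl₅, hm₅, hr₅⟩ := presentation_comp_ringEquiv (T := AdjoinRoot (h'.map (algebraMap S (Localization.AtPrime q))))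
    (T' := (Localization.AtPrime q)[X] ⧸ Ideal.span {(h'.map (algebraMap S (Localization.AtPrime q))).comp (X + C θ')})
    _ hf₄ hl₄ hm₄ hr₄ e₅
  -- the dimension of `S_𝔮`
  have hdimS : ringKrullDim (Localization.AtPrime q) = ringKrullDim R := by
    haveI : Module.Finite (Localization.AtPrime q) (AdjoinRoot (h'.map (algebraMap S (Localization.AtPrime q)))) :=
      (hmon'.map _).finite_adjoinRoot
    haveI : Module.Finite R (AdjoinRoot h) := hmo.finite_adjoinRoot
    haveI : IsDomain (Localization.AtPrime q) := isDomain_of_isRegularLocalRing _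
    haveI : IsDomain R := isDomain_of_isRegularLocalRing R
    have hdegq : (h'.map (algebraMap S (Localization.AtPrime q))).degree ≠ 0 := by
      rw [degree_eq_natDegree (hmon'.map _).ne_zero, hmon'.natDegree_map, hdeg']
      exact_mod_cast hm.ne'
    have hdegh : h.degree ≠ 0 := by
      rw [degree_eq_natDegree hmo.ne_zero]
      exact_mod_cast hm.ne'
    have h1 := Literature.RingTheory.KrullDimension.ringKrullDim_eq_of_isIntegral (R := Localization.AtPrime q)
      (S := AdjoinRoot (h'.map (algebraMap S (Localization.AtPrime q)))) (AdjoinRoot.of.injective_of_degree_ne_zero hdegq)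
    have h2 := Literature.RingTheory.KrullDimension.ringKrullDim_eq_of_isIntegral (R := R) (S := AdjoinRoot h)
      (AdjoinRoot.of.injective_of_degree_ne_zero hdegh)
    rw [h1, ← ringKrullDim_eq_of_ringEquiv e₄.toRingEquiv, hdim₃, h2]
  exact ⟨θ', hloc₁, _, hdimS, hmo₁, hdeg₁.trans hdeg', fun i hi => by
      have := hco₁ i (hdeg' ▸ hi); rwa [hdeg'] at this, hf₅, hl₅, hm₅, hr₅⟩

end Summit.ResolutionOfSingularities.ResolutionOfSingularities.Theorems.SigmaMaxModificationsCorridor3.Helpers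

end
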